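import Summits.BirchSwinnertonDyer.BirchSwinnertonDyer.Theorems.InertBadSignedBranchesInertBadAtThreeQuarticStubOfDictionary
import Summits.BirchSwinnertonDyer.BirchSwinnertonDyer.Theorems.InertBadSignedBranchesInertBadAtThreeQuarticThetaSymbol
import Literature.NumberTheory.EllipticCurves.QuarticTwistThetaDictionary
import HarnessLib

/-!
# The registered stub `stub_plainOddNeronIntegralThreeQuartic` of line `rubin_e1_inert_three` — PROVED
# (theta dictionary for `y² = x³ + Ax` packaged in the assembly's currency, then the `V`-level closer of record)

Summit `BirchSwinnertonDyer`, crux `InertBadAtThree` (stmt-BirchSwinnertonDyer-19225; K8 `InertBadSignedBranches` r4 / BED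
`BiquadraticEisensteinDescent` r5), line of record `Cruxes/InertBadAtThree/Lines/rubin_e1_inert_three.lean` v5 cf92aff39960433f (lead
`bsd-line-ibd-p1`). This file closes the line's second stub, `stub_plainOddNeronIntegralThreeQuartic` (the PLAIN ODD form of C⁺_quartic:
`3`-integrality in Néron units of the odd twisted symbol sums of the conductor-level newform of every globally minimal `V` with `j = 1728` bad
at `3`, prime moduli `ℓ ∤ N_V`, `ℓ ≡ 11 (mod 12)`, `χ(3) ≠ 1`), by name and with the registered signature VERBATIM. It is the last link of
the STUB-PLAN wave (ideator bsd-idea-18 g8/g9; width seats bsd-wall-cm-bed-w1 g7 · w2 g8/g9 · w3 g8 · w4 g9; lead g6/g7):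

* `exists_neg_eq_neg_three_pow_mul` — `−A = (−3)^{v₃(A)} · D₁` with `3 ∤ D₁ ≠ 0`;
* ★ `model_thetaDictionary` — THE THETA DICTIONARY (STUB-PLAN P1b) for the model `E_A = ⟨0,0,0,A,0⟩` (`A ≠ 0`, `3 ∣ A`, `A` free of fourth
  powers), every modulus `m` with `3 ∤ m` and every Dirichlet character `χ` mod `m`, in the currency of the P6 assembly
  (`…QuarticCleanAssemblyOdd.oddLValue_quartic_of_dictionary`): `∃ M' Ψ`, `(3, M') = 1`, `Ψ` periodic modulo `M'` with algebraic-integer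
  values, and `Σ χ̄(n) a_n(E_A) n⁻ˢ = ¼ · Θ-L_{3M'}(conj((·/3)₄)^{v₃ A} · Ψ)(s)` for `re s > 2`. Source of the mathematics: bsd-wall-cm-bed-w4 g9's
  `Literature/NumberTheory/EllipticCurves/QuarticTwistThetaDictionary` (Ireland–Rosen Thm 18.7 as a weight-one theta series of `ℤ[i]`:
  `lSeries_twist_eq_thetaLFunction`, `thetaWeight_periodic`, `isIntegral_thetaWeight`, `thetaWeight_three_split`), here re-levelled from
  `8|A|m` to `3M'`, `M' = 8|D₁|m` (`hasSum_thetaLFunction` on `re s > 3/2`, the two periodic coefficients agree pointwise);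
* ★ **`stub_plainOddNeronIntegralThreeQuartic`** — the registered stub, by bsd-wall-cm-bed-w3 g8's
  `…QuarticStubOfDictionary.plainOddNeronIntegralThreeQuartic_of_dictionary` (k-range model + `LValueOdd_of_smul` + `plainOdd_of_LValue` over the
  lead's `oddLValue_quartic_of_dictionary`) fed with `model_thetaDictionary` and bsd-wall-cm-bed-w2 g9's table lemma `toComplex_quarticCharThree`.

HONEST FRAMING: this proves ONE registered stub of the line (a classical CM computation: Birch–Manin twisted values of the quartic twists
`y² = x³ − Dx`, `3 ∣ D`, are `3`-integral in Néron units on the odd prime-modulus branch). The crux `InertBadAtThree` is NOT closed: its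
composition still needs `stub_heartAtThree` (research, W-19) and the held print `stub_printedInputsAtThreeCM`. BSD is not proved by any of this.
No definitions, no named facts, no `sorry`; axioms standard.
-/

set_option linter.dupNamespace false
set_option autoImplicit false

noncomputable section

open scoped ComplexConjugate
open Complex
open Literature.NumberTheory.EllipticCurves Literature.NumberTheory.EllipticCurves.ModularForms
open Literature.NumberTheory.LFunctions Literature.NumberTheory.LFunctions.GaussianTheta
open Literature.NumberTheory.QuadraticFields.GaussianPrimary Literature.NumberTheory.QuadraticFields.GaussianQuarticSymbol
open Literature.NumberTheory.EllipticCurves.GaussianPrimary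

namespace Summit.BirchSwinnertonDyer.BirchSwinnertonDyer.Theorems.InertBadSignedBranchesInertBadAtThreeQuarticStub

open Summit.BirchSwinnertonDyer.BirchSwinnertonDyer.Theorems.InertBadSignedBranchesInertBadAtThreeQuarticTheta
  (toComplex_quarticCharThree quarticCharThree_add_three_mul)

/-! ## §1 `−A = (−3)^{v₃(A)} · D₁`, `3 ∤ D₁` -/

/-- `−A = (−3)^{v₃(A)} · D₁` with `D₁ ≠ 0` and `3 ∤ D₁`, for `A ≠ 0`. [folklore] -/
theorem exists_neg_eq_neg_three_pow_mul {A : ℤ} (hA : A ≠ 0) :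
    ∃ D₁ : ℤ, D₁ ≠ 0 ∧ ¬ (3 : ℤ) ∣ D₁ ∧ -A = (-3) ^ (padicValInt 3 A) * D₁ := by
  haveI : Fact (Nat.Prime 3) := ⟨Nat.prime_three⟩
  set k : ℕ := padicValInt 3 A with hk
  obtain ⟨B, hB⟩ : ((3 : ℕ) : ℤ) ^ k ∣ A := (padicValInt_dvd_iff _ A).mpr (Or.inr le_rfl)
  have hB' : A = 3 ^ k * B := by simpa using hB
  have hB0 : B ≠ 0 := by rintro rfl; exact hA (by rw [hB', mul_zero])
  have h3B : ¬ (3 : ℤ) ∣ B := by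
    rintro ⟨C, hC⟩
    have h : ((3 : ℕ) : ℤ) ^ (k + 1) ∣ A := ⟨C, by rw [hB', hC]; push_cast; ring⟩
    rcases (padicValInt_dvd_iff (p := 3) _ A).mp h with h0 | h0
    · exact hA h0
    · omega
  refine ⟨-((-1) ^ k * B), ?_, ?_, ?_⟩
  · exact neg_ne_zero.mpr (mul_ne_zero (pow_ne_zero _ (by norm_num)) hB0)
  · intro h
    rw [dvd_neg] at h
    exact h3B ((isUnit_one.neg.pow _).dvd_mul_left.mp h)
  · have h33 : ((-3 : ℤ)) ^ k * ((-1) ^ k) = 3 ^ k := by rw [← mul_pow]; norm_num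
    rw [hB']
    linear_combination B * h33

/-! ## §2 The theta dictionary for the model, in the assembly's currency -/

/-- ★ **STUB-PLAN P1b for the model `E_A = ⟨0,0,0,A,0⟩`** (`A ≠ 0`, `3 ∣ A`, `A` free of fourth powers; any `m` with `3 ∤ m`, any `χ` mod `m`):
there are `M'` with `(3, M') = 1` and `Ψ : ℤ[i] → ℂ` periodic modulo `M'` with algebraic-integer values such that
`Σ_n χ̄(n) a_n(E_A) n⁻ˢ = ¼ · Θ-L_{3M'}(conj((·/3)₄)^{v₃(A)} · Ψ)(s)` for `re s > 2` — Ireland–Rosen Thm 18.7 for `D = −A = (−3)^k D₁` (bed-w4 g9's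
`QuarticTwist.lSeries_twist_eq_thetaLFunction`) with the prime `3` split off the coefficient (`thetaWeight_three_split`), re-levelled to
`3M'`, `M' = 8|D₁|m`. [cite: IrelandRosen1990, Ch. 18 §6, Theorem 7] [cite: Rubin1999, Prop. 7.15] -/
theorem model_thetaDictionary (A : ℤ) (hA : A ≠ 0) (h3A : (3 : ℤ) ∣ A) (h4 : ∀ p : ℕ, p.Prime → ¬ ((p : ℤ) ^ 4 ∣ A))
    (m : ℕ) [NeZero m] (h3m : ¬ 3 ∣ m) (χ : DirichletCharacter ℂ m) :
    ∃ (M' : ℕ) (_ : NeZero M') (_ : NeZero (3 * M')) (Ψ : GaussianInt → ℂ),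
      Nat.Coprime 3 M' ∧ (∀ x y : GaussianInt, Ψ (x + M' * y) = Ψ x) ∧ (∀ x : GaussianInt, IsIntegral ℤ (Ψ x)) ∧
      ∀ s : ℂ, 2 < s.re →
        LSeries (fun n : ℕ ↦ χ⁻¹ (n : ZMod m) * ((⟨0, 0, 0, (A : ℚ), 0⟩ : WeierstrassCurve ℚ).LFunction n : ℂ)) s =
          (1 / 4 : ℂ) * thetaLFunction (3 * M')
            (fun x ↦ (conj (((quarticCharThree x : GaussianInt) : ℂ))) ^ (padicValInt 3 A) * Ψ x) s := by
  haveI : Fact (Nat.Prime 3) := ⟨Nat.prime_three⟩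
  set k : ℕ := padicValInt 3 A with hk
  have hk0 : k ≠ 0 := by
    intro h0
    rcases (padicValInt_dvd_iff (p := 3) 1 A).mp (by simpa using h3A) with h | h
    · exact hA h
    · omega
  obtain ⟨D₁, hD₁0, h3D₁, hDA⟩ := exists_neg_eq_neg_three_pow_mul hA
  set D : ℤ := -A with hD
  have hD0 : D ≠ 0 := neg_ne_zero.mpr hA
  have hD4 : ∀ p : ℕ, p.Prime → ¬ ((p : ℤ) ^ 4 ∣ D) := fun p hp h ↦ h4 p hp (by rwa [hD, dvd_neg] at h)
  -- the modulus `M' = 8 |D₁| m`, prime to `3`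
  set M' : ℕ := 8 * D₁.natAbs * m with hM'
  haveI hM'0 : NeZero M' := ⟨by rw [hM']; positivity [Int.natAbs_ne_zero.mpr hD₁0, NeZero.ne m]⟩
  haveI h3M'0 : NeZero (3 * M') := ⟨mul_ne_zero three_ne_zero (NeZero.ne M')⟩
  have hcop : Nat.Coprime 3 M' := by
    rw [hM']
    refine Nat.Coprime.mul_right (Nat.Coprime.mul_right (by norm_num) ?_) ?_
    · exact (Nat.Prime.coprime_iff_not_dvd Nat.prime_three).mpr (fun h ↦ h3D₁ (Int.ofNat_dvd_left.mpr h))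
    · exact (Nat.Prime.coprime_iff_not_dvd Nat.prime_three).mpr h3m
  -- the two theta coefficients: `Ψ_D` (level `8|D|m`) and its `3`-free part `Ψ` (level `M'`)
  set c : ZMod m → ℂ := fun a ↦ χ⁻¹ a with hc
  set ΨD : GaussianInt → ℂ := fun x ↦
    (if IsCoprime x.norm D then ((star (quarticSymbolInt D x) * primaryUnit x : GaussianInt) : ℂ) else 0) *
      c (x.norm : ZMod m) with hΨD
  set Ψ : GaussianInt → ℂ := fun x ↦
    (if IsCoprime x.norm D₁ then
      ((star (quarticSymbolInt D₁ x) * (star (quarticCharThree (primaryUnit x)) ^ k * primaryUnit x) : GaussianInt) : ℂ) else 0) *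
      c (x.norm : ZMod m) with hΨ
  have hΨper : ∀ x y : GaussianInt, Ψ (x + (M' : GaussianInt) * y) = Ψ x := fun x y ↦
    QuarticTwist.thetaWeight_periodic hD₁0 (fun u ↦ star (quarticCharThree u) ^ k * u) (by simp) c (Ψ := Ψ) (fun _ ↦ rfl) x y
  have hΨint : ∀ x : GaussianInt, IsIntegral ℤ (Ψ x) := fun x ↦
    QuarticTwist.isIntegral_thetaWeight (D := D₁) (fun u ↦ star (quarticCharThree u) ^ k * u)
      (c := c) (fun a ↦ isIntegral_dirichletCharacter_apply χ⁻¹ a) (Ψ := Ψ) (fun _ ↦ rfl) x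
  have hsplit : ∀ x : GaussianInt, ΨD x = ((star (quarticCharThree x) : GaussianInt) : ℂ) ^ k * Ψ x := fun x ↦
    QuarticTwist.thetaWeight_three_split (D := D) hk0 D₁ hDA c (Ψ := ΨD) (Ψ' := Ψ) (fun _ ↦ rfl) (fun _ ↦ rfl) x
  refine ⟨M', hM'0, h3M'0, Ψ, hcop, hΨper, hΨint, fun s hs ↦ ?_⟩
  have hs' : 3 / 2 < s.re := by linarith
  haveI : NeZero (8 * D.natAbs * m) := ⟨by positivity [Int.natAbs_ne_zero.mpr hD0, NeZero.ne m]⟩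
  -- Ireland–Rosen 18.7 at level `8|D|m`
  have h1 : LSeries (fun n : ℕ ↦ χ⁻¹ (n : ZMod m) * ((⟨0, 0, 0, (A : ℚ), 0⟩ : WeierstrassCurve ℚ).LFunction n : ℂ)) s =
      (1 / 4 : ℂ) * thetaLFunction (8 * D.natAbs * m) ΨD s := by
    have h := QuarticTwist.lSeries_twist_eq_thetaLFunction hD0 hD4 c (Ψ := ΨD) (fun _ ↦ rfl) hs'
    have hmodel : (⟨0, 0, 0, -(D : ℚ), 0⟩ : WeierstrassCurve ℚ) = ⟨0, 0, 0, (A : ℚ), 0⟩ := by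
      rw [hD]; push_cast; ring_nf
    rw [hmodel] at h
    exact h
  -- re-levelling: both theta `L`-values are the sum `Σ_x Ψ_D(x) x N(x)^{-s}` on `re s > 3/2`
  have hΦper : ∀ x y : GaussianInt,
      (conj (((quarticCharThree (x + (3 * M' : ℕ) * y) : GaussianInt) : ℂ))) ^ k * Ψ (x + (3 * M' : ℕ) * y) =
        (conj (((quarticCharThree x : GaussianInt) : ℂ))) ^ k * Ψ x := by
    intro x y
    rw [show x + ((3 * M' : ℕ) : GaussianInt) * y = x + 3 * ((M' : GaussianInt) * y) by push_cast; ring,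
      quarticCharThree_add_three_mul, show x + 3 * ((M' : GaussianInt) * y) = x + (M' : GaussianInt) * (3 * y) by ring, hΨper]
  have hsumD := hasSum_thetaLFunction (8 * D.natAbs * m) ΨD (QuarticTwist.thetaWeight_periodic hD0 id rfl c (Ψ := ΨD) (fun _ ↦ rfl)) hs'
  have hsumΦ := hasSum_thetaLFunction (3 * M')
    (fun x ↦ (conj (((quarticCharThree x : GaussianInt) : ℂ))) ^ k * Ψ x) hΦper hs'
  have hfun : (fun x : GaussianInt ↦ (conj (((quarticCharThree x : GaussianInt) : ℂ))) ^ k * Ψ x * (x : ℂ) /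
      (((x.norm : ℤ) : ℂ)) ^ s) = (fun x : GaussianInt ↦ ΨD x * (x : ℂ) / (((x.norm : ℤ) : ℂ)) ^ s) := by
    funext x
    rw [hsplit x, ← GaussianInt.toComplex_star]
  rw [hfun] at hsumΦ
  rw [h1, hsumD.unique hsumΦ]

/-! ## §3 The registered stub -/

/-- ★ **`stub_plainOddNeronIntegralThreeQuartic` — the registered stub of line `rubin_e1_inert_three` v5 (crux `InertBadAtThree`,
stmt-BirchSwinnertonDyer-19225), signature VERBATIM, PROVED**: for every globally minimal `V/ℚ` with `j(V) = 1728` bad at `3`, its newform `f` at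
conductor level, every prime `ℓ ∤ N_V` with `ℓ ≡ 11 (mod 12)`, every odd `χ` mod `ℓ` with `χ(3) ≠ 1`, and `ϖ, r` with `ϖ·Ω⁻(V) = Ω⁻_f`,
`Σ_a χ(a){∞, a/ℓ}_f = r·Ω⁻_f·i`: `s·ϖ·r ∈ ℤ̄` for some `3 ∤ s`. Proof = the `V`-level closer of record
(`…QuarticStubOfDictionary.plainOddNeronIntegralThreeQuartic_of_dictionary`, bed-w3 g8) ∘ the theta dictionary `model_thetaDictionary`
(Ireland–Rosen 18.7, bed-w4 g9) ∘ the P6 assembly (finite Eisenstein–Kronecker formula on `ℤi + ℤ`, CRT, closed forms of the `χ₄^k`-twisted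
`3`-torsion sums of `E₁*`, torsion integrality, model periods). [cite: IrelandRosen1990, Ch. 18 §6, Theorem 7] [cite: Rubin1999, Prop. 7.15]
[cite: MazurTateTeitelbaum1986, §I.8 (8.6)] [cite: Kato2004Asterisque, Thm. 9.7 (p. 189)] -/
theorem stub_plainOddNeronIntegralThreeQuartic :
    ∀ (V : WeierstrassCurve ℚ) [V.IsElliptic] [V.IsGloballyMinimal] [NeZero (V.conductorNorm ℤ)],
      V.j = 1728 → ¬ V.HasGoodReductionAtPrime 3 →
      ∀ (f : CuspForm (CongruenceSubgroup.Gamma0 (V.conductorNorm ℤ)) 2),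
        Literature.NumberTheory.EllipticCurves.ModularForms.IsNewformOf V f →
      ∀ (ℓ : ℕ) [NeZero ℓ], ℓ.Prime → ¬ ℓ ∣ V.conductorNorm ℤ → ℓ % 12 = 11 →
      ∀ χ : DirichletCharacter ℂ ℓ, χ.Odd → χ (3 : ZMod ℓ) ≠ 1 →
      ∀ (ϖ : ℚ) (r : ℂ), (ϖ : ℝ) * V.imaginaryPeriodRat = Literature.NumberTheory.EllipticCurves.ModularForms.minusPeriod f →
        Literature.NumberTheory.EllipticCurves.ModularForms.twistedSymbolSum f χ =
          r * (Literature.NumberTheory.EllipticCurves.ModularForms.minusPeriod f : ℂ) * Complex.I →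
        ∃ s : ℕ, ¬ 3 ∣ s ∧ IsIntegral ℤ ((s : ℂ) * ϖ * r) := by
  refine InertBadSignedBranchesInertBadAtThreeQuarticStubOfModel.plainOddNeronIntegralThreeQuartic_of_dictionary
    (q := fun x ↦ ((quarticCharThree x : GaussianInt) : ℂ)) toComplex_quarticCharThree ?_
  intro A hA0 h3A h4 ℓ _ hℓ h12 _ χ _ _
  have h3ℓ : ¬ 3 ∣ ℓ := by
    intro h
    have := (Nat.prime_dvd_prime_iff_eq Nat.prime_three hℓ).mp h
    omega
  exact model_thetaDictionary A hA0 h3A h4 ℓ h3ℓ χ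

end Summit.BirchSwinnertonDyer.BirchSwinnertonDyer.Theorems.InertBadSignedBranchesInertBadAtThreeQuarticStub

end
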